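import Literature.Probability.RandomPlanarGeometry.HexSAWBrickWallStripFugacityWidthOneLinearContactStatistics
import Literature.Probability.RandomPlanarGeometry.HexSAWBrickWallStripFugacityWidthOneContactCLT
import HarnessLib

/-!
# The joint Gaussian fluctuations of the two contact numbers, in Cramér–Wold form:
# `E e^{s(L − N m_v)/√N} → e^{H(v)s²/2}` and `(L − N m_v)/√N ⇒ N(0, H(v))` for EVERY linear statistic `L = v₁·bc + v₂·tc`

Topic `Literature/Probability/RandomPlanarGeometry` (continues `…WidthOneLinearContactStatistics.lean` (the free energy along the line `t ↦ (y e^{tv₁}, z e^{tv₂})`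
is `C²` with `Λ_v' = m_v := v₁b + v₂b'`, `Λ_v'' = H(v)` — `contDiff_two_log_stripMuY₂_line`; the amplitude correction along the line is `C²`; the
rectangle remainder; `Var(v₁bc + v₂tc)/N → H(v)`), `…WidthOneContactGaussianMGF.lean` (the bottom-wall case `v = (1,0)`), `…WidthOneContactCLT.lean`
(`finLaw`, the law of a finitely supported statistic as a Mathlib measure; the bottom-wall CLT) and `Literature/Probability/Moments/MGFContinuityTheorem.lean`
(Curtiss' continuity theorem `tendsto_gaussianReal_of_tendsto_mgf`)).  THIS FILE proves, for EVERY direction `v = (v₁,v₂)`: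

* §1 ★★★ `tendsto_linMGF_gaussian`: `C_{1,N}(y e^{sv₁/√N}, z e^{sv₂/√N})/C_{1,N}(y,z) · e^{−s√N·m_v} → e^{H_{y,z}(v)s²/2}` for every real `s` — the mgf of
  the centred, `√N`-scaled linear statistic `(v₁bc + v₂tc − N m_v)/√N` converges to that of `N(0, H(v))` (second-order Taylor squeeze of `Λ_v`, continuity of
  the amplitude correction, the rectangle remainder along both parities — the proof of CAR «GAUSSIAN MGF» run along the line).
* §2 `linLaw v₁ v₂ y z N` (the law of `(L − N m_v)/√N` under `P_{N,y,z}` as a measure), `integral_exp_mul_linLaw`, `linLaw_real_Iic`;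
  ★★★★ `tendsto_linLaw` — `law((v₁bc + v₂tc − N m_v)/√N) ⟶ N(0, H_{y,z}(v))` WEAKLY for every `v` (CRAMÉR–WOLD form of the joint central limit theorem
  of `(bc, tc)`: every linear combination is asymptotically Gaussian with the variance given by the free-energy Hessian); ★★★ `tendsto_linCDF`
  (`P_{N,y,z}(v₁bc + v₂tc ≤ N m_v + x√N) → N(0,H(v))(−∞,x]` for every `x`, `v ≠ 0`).
* §3 ★★★ THE TOTAL NUMBER OF SURFACE CONTACTS: `tendsto_totalContactCDF` — `P_{N,y,z}(bc + tc ≤ N(b + b') + x√N) → N(0, H(1,1))(−∞, x]`, `'` with the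
  Gaussian integral displayed.

Numerics (`cw_check.py`, exact bivariate series, both fugacities symbolic, stdlib): `(y,z) = (1,1)`: the ANTI-diagonal statistic `bc − tc`
(`m_v = 0`, `H(1,−1) = 0.5451`): `P_N(bc − tc ≤ x√N)` at `x = −√H, 0, +√H`, `N = 50, 100, 200, 400`: `0.1402, 0.1523, 0.1561, 0.1624 → Φ(−1) = 0.1587`;
`0.5388, 0.5273, 0.5192, 0.5135 → 0.5`; `0.8598, 0.8477, 0.8439, 0.8376 → Φ(1) = 0.8413`; the TOTAL `bc + tc` (`m_v = 0.4115`, `H(1,1) = 0.01708`,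
so `√(HN) ≈ 2.6` lattice units at `N = 400`: strong lattice/parity effects at these sizes): `0.051, 0.054, 0.111, 0.086 → 0.159`; `0.284, 0.463, 0.442,
0.414 → 0.5`; `0.677, 0.742, 0.821, 0.821 → 0.841`.  `(2,1)`: `bc − tc`: `0.1871, 0.1644, 0.1601, 0.1589 → 0.1587`; `0.5169, 0.5309, 0.5136, 0.4982 → 0.5`;
`0.8443, 0.8485, 0.8394, 0.8434 → 0.8413`.

## Sources
H. Cramér, H. Wold (1936) (the device: a law on `ℝ²` is determined by its one-dimensional projections — here only the projections are treated);
J. H. Curtiss, Ann. Math. Statist. 13 (1942) Theorem 3; A. Dembo, O. Zeitouni (2010) §2.3 (lane statements); R. Durrett (2019) §3.2 Theorem 3.2.11 (iv)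
(book p. 124); N. R. Beaton, M. Bousquet-Mélou, J. de Gier, H. Duminil-Copin, A. J. Guttmann, CMP 326 (2014), arXiv:1109.0358v5 §3.2 Proposition 6 (p. 10);
E. J. Janse van Rensburg (2000) §3.3.  Nothing is quoted AS PRINTED; statements and constants are this lineage's.
-/

noncomputable section

open Filter Topology Finset Set MeasureTheory ProbabilityTheory Literature.Analysis Literature.Probability.Moments
open Literature.Probability.LatticeModels Literature.Probability.Percolation

namespace Literature.Probability.RandomPlanarGeometry.SAW.HexBW

namespace WidthOneYZ

variable {y z : ℝ}

/-! ## §1 ★★★ The Gaussian limit of the mgf of every linear contact statistic -/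

/-- If `ψ(0) = 0`, `ψ' = ψ₁` with `ψ₁(0) = 0`, `ψ₁' = ψ₂` and `|ψ₂| ≤ η` on `[-δ, δ]`, then `|ψ(u)| ≤ η·u²` for `|u| ≤ δ` (plumbing copy of the
tree's private squeeze). [cite: DemboZeitouni2010, §2.3 (lane plumbing)] -/
private theorem abs_le_of_second_deriv_bound_cw {ψ ψ₁ ψ₂ : ℝ → ℝ} {δ η : ℝ} (h0 : ψ 0 = 0) (h10 : ψ₁ 0 = 0)
    (hd : ∀ u, HasDerivAt ψ (ψ₁ u) u) (hd1 : ∀ u, HasDerivAt ψ₁ (ψ₂ u) u) (hη : ∀ u ∈ Icc (-δ) δ, |ψ₂ u| ≤ η)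
    {u : ℝ} (hu : u ∈ Icc (-δ) δ) : |ψ u| ≤ η * u ^ 2 := by
  have hη0 : 0 ≤ η := by
    have := hη 0 ⟨by linarith [hu.1, hu.2], by linarith [hu.1, hu.2]⟩
    exact le_trans (abs_nonneg _) this
  -- `|ψ₁ v| ≤ η |v|` on `[-δ, δ]` (mean value theorem), then once more
  have step1 : ∀ v, v ∈ Icc (-δ) δ → |ψ₁ v| ≤ η * |v| := by
    intro v hv
    rcases lt_trichotomy v 0 with hv0 | hv0 | hv0
    · obtain ⟨ξ, hξ, e⟩ := exists_hasDerivAt_eq_slope ψ₁ ψ₂ hv0 (fun t _ => (hd1 t).continuousAt.continuousWithinAt)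
        (fun t _ => hd1 t)
      rw [h10] at e
      have e' : ψ₁ v = ψ₂ ξ * v := by
        have : 0 - ψ₁ v = ψ₂ ξ * (0 - v) := by rw [e, div_mul_cancel₀ _ (sub_ne_zero.2 hv0.ne')]
        linarith
      rw [e', abs_mul]
      exact mul_le_mul_of_nonneg_right (hη ξ ⟨by linarith [hξ.1, hξ.2, hv.1, hv.2], by linarith [hξ.1, hξ.2, hv.1, hv.2]⟩) (abs_nonneg _)
    · subst hv0; rw [h10]; simp
    · obtain ⟨ξ, hξ, e⟩ := exists_hasDerivAt_eq_slope ψ₁ ψ₂ hv0 (fun t _ => (hd1 t).continuousAt.continuousWithinAt)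
        (fun t _ => hd1 t)
      rw [h10] at e
      have e' : ψ₁ v = ψ₂ ξ * v := by
        have : ψ₁ v - 0 = ψ₂ ξ * (v - 0) := by rw [e, div_mul_cancel₀ _ (sub_ne_zero.2 hv0.ne')]
        linarith
      rw [e', abs_mul]
      exact mul_le_mul_of_nonneg_right (hη ξ ⟨by linarith [hξ.1, hξ.2, hv.1, hv.2], by linarith [hξ.1, hξ.2, hv.1, hv.2]⟩) (abs_nonneg _)
  rcases lt_trichotomy u 0 with hu0 | hu0 | hu0
  · obtain ⟨ξ, hξ, e⟩ := exists_hasDerivAt_eq_slope ψ ψ₁ hu0 (fun t _ => (hd t).continuousAt.continuousWithinAt) (fun t _ => hd t)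
    rw [h0] at e
    have e' : ψ u = ψ₁ ξ * u := by
      have : 0 - ψ u = ψ₁ ξ * (0 - u) := by rw [e, div_mul_cancel₀ _ (sub_ne_zero.2 hu0.ne')]
      linarith
    have hξb := step1 ξ ⟨by linarith [hξ.1, hξ.2, hu.1, hu.2], by linarith [hξ.1, hξ.2, hu.1, hu.2]⟩
    rw [e', abs_mul]
    have : |ξ| ≤ |u| := by rw [abs_of_neg hξ.2, abs_of_neg hu0]; linarith [hξ.1]
    calc |ψ₁ ξ| * |u| ≤ η * |ξ| * |u| := mul_le_mul_of_nonneg_right hξb (abs_nonneg _)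
      _ ≤ η * |u| * |u| := by gcongr
      _ = η * u ^ 2 := by rw [mul_assoc, ← sq, sq_abs]
  · subst hu0; rw [h0]; simp
  · obtain ⟨ξ, hξ, e⟩ := exists_hasDerivAt_eq_slope ψ ψ₁ hu0 (fun t _ => (hd t).continuousAt.continuousWithinAt) (fun t _ => hd t)
    rw [h0] at e
    have e' : ψ u = ψ₁ ξ * u := by
      have : ψ u - 0 = ψ₁ ξ * (u - 0) := by rw [e, div_mul_cancel₀ _ (sub_ne_zero.2 hu0.ne')]
      linarith
    have hξb := step1 ξ ⟨by linarith [hξ.1, hξ.2, hu.1, hu.2], by linarith [hξ.1, hξ.2, hu.1, hu.2]⟩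
    rw [e', abs_mul]
    have : |ξ| ≤ |u| := by rw [abs_of_pos hξ.1, abs_of_pos hu0]; linarith [hξ.2]
    calc |ψ₁ ξ| * |u| ≤ η * |ξ| * |u| := mul_le_mul_of_nonneg_right hξb (abs_nonneg _)
      _ ≤ η * |u| * |u| := by gcongr
      _ = η * u ^ 2 := by rw [mul_assoc, ← sq, sq_abs]

/-- `N/2 → ∞` along `ℕ` (plumbing). [cite: DemboZeitouni2010, §2.3 (lane plumbing)] -/
private theorem tendsto_nat_div_two_cw : Tendsto (fun N : ℕ => N / 2) atTop atTop :=
  tendsto_atTop_atTop.2 fun b => ⟨2 * b, fun N h => by omega⟩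

/-- ★★★ **GAUSSIAN MGF OF EVERY LINEAR CONTACT STATISTIC.**  For all `y, z > 0`, every direction `(v₁,v₂)` and every real `s`, with
`m_v = v₁ b(y,z) + v₂ b(z,y)` and `H = H_{y,z}(v)` (`contactHess`):
`C_{1,N}(y e^{(s/√N)v₁}, z e^{(s/√N)v₂})/C_{1,N}(y,z) · e^{−s√N·m_v} → exp(H s²/2)`,
i.e. `E_{N,y,z} e^{s(v₁bc + v₂tc − N m_v)/√N} → E e^{sZ}`, `Z ~ N(0, H(v))`.  Proof: CAR «GAUSSIAN MGF» along the line — second-order Taylor squeeze of the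
`C²` free energy `Λ_v`, continuity of `log A_c` along the line, the rectangle remainder along both parities.
[cite: DemboZeitouni2010, §2.3 (lane statement: local expansion of the free energy ⇒ Gaussian mgf); BeatonBousquetMelouDeGierDuminilCopinGuttmann2014, §3.2 Proposition 6 (arXiv v5 p. 10); MadrasSlade1993, §1.1 eq. (1.1.4) p. 5] -/
theorem tendsto_linMGF_gaussian (hy : 0 < y) (hz : 0 < z) (v₁ v₂ s : ℝ) :
    Tendsto (fun N : ℕ => stripZ₂ 1 N (y * Real.exp (s / Real.sqrt N * v₁)) (z * Real.exp (s / Real.sqrt N * v₂)) / stripZ₂ 1 N y z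
        * Real.exp (-(s * Real.sqrt N * (v₁ * contactB y z + v₂ * contactB z y)))) atTop
      (𝓝 (Real.exp (contactHess v₁ v₂ y z * s ^ 2 / 2))) := by
  set A₀ := Real.log y with hA₀
  set B₀ := Real.log z with hB₀
  have hyA : Real.exp A₀ = y := Real.exp_log hy
  have hzB : Real.exp B₀ = z := Real.exp_log hz
  have ept : ∀ t, y * Real.exp (t * v₁) = Real.exp (A₀ + t * v₁) ∧ z * Real.exp (t * v₂) = Real.exp (B₀ + t * v₂) := fun t => by
    constructor <;> rw [Real.exp_add] <;> simp [hyA, hzB]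
  -- the free energy along the line
  obtain ⟨Λ, hΛdef⟩ : ∃ Λ : ℝ → ℝ, Λ = fun t => Real.log (stripMuY₂ 1 (Real.exp (A₀ + t * v₁)) (Real.exp (B₀ + t * v₂))) := ⟨_, rfl⟩
  set Λ1 : ℝ → ℝ := fun t => v₁ * contactB (Real.exp (A₀ + t * v₁)) (Real.exp (B₀ + t * v₂))
      + v₂ * contactB (Real.exp (B₀ + t * v₂)) (Real.exp (A₀ + t * v₁)) with hΛ1
  set Λ2 : ℝ → ℝ := fun t => contactHess v₁ v₂ (Real.exp (A₀ + t * v₁)) (Real.exp (B₀ + t * v₂)) with hΛ2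
  obtain ⟨hΛC2, hΛd, hΛdd, hΛ2c⟩ := contDiff_two_log_stripMuY₂_line A₀ B₀ v₁ v₂
  have hΛd' : ∀ t, HasDerivAt Λ (Λ1 t) t := fun t => by rw [hΛdef]; exact hΛd t
  have hΛdd' : ∀ t, HasDerivAt Λ1 (Λ2 t) t := fun t => hΛdd t
  set m := v₁ * contactB y z + v₂ * contactB z y with hm
  set σ2 := contactHess v₁ v₂ y z with hσ2
  have hmΛ : Λ1 0 = m := by simp only [hΛ1, zero_mul, add_zero, hyA, hzB, hm]
  have hσΛ : Λ2 0 = σ2 := by simp only [hΛ2, zero_mul, add_zero, hyA, hzB, hσ2]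
  -- the scale `u_N = s/√N`
  set u : ℕ → ℝ := fun N => s / Real.sqrt N with hu
  have hu0 : Tendsto u atTop (𝓝 0) := by
    have h1 : Tendsto (fun N : ℕ => Real.sqrt (N : ℝ)) atTop atTop :=
      Real.tendsto_sqrt_atTop.comp tendsto_natCast_atTop_atTop
    have := h1.inv_tendsto_atTop.const_mul s
    rw [mul_zero] at this
    exact this.congr fun N => by simp [hu, div_eq_mul_inv]
  have huN : ∀ N : ℕ, 1 ≤ N → (N : ℝ) * u N = s * Real.sqrt N ∧ (N : ℝ) * u N ^ 2 = s ^ 2 := by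
    intro N hN
    have hN0 : (0 : ℝ) < N := by exact_mod_cast hN
    have hs : Real.sqrt (N : ℝ) ≠ 0 := (Real.sqrt_pos.2 hN0).ne'
    have hNN : (N : ℝ) = Real.sqrt N * Real.sqrt N := (Real.mul_self_sqrt hN0.le).symm
    constructor
    · show (N : ℝ) * (s / Real.sqrt N) = s * Real.sqrt N
      nth_rewrite 1 [hNN]; field_simp
    · show (N : ℝ) * (s / Real.sqrt N) ^ 2 = s ^ 2
      rw [div_pow, Real.sq_sqrt hN0.le]; field_simp
  -- the second-order Taylor remainder of `Λ` at `0`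
  set ψ : ℝ → ℝ := fun w => Λ w - Λ 0 - m * w - σ2 * (w * w) / 2 with hψ
  set ψ1 : ℝ → ℝ := fun w => Λ1 w - m - σ2 * w with hψ1
  set ψ2 : ℝ → ℝ := fun w => Λ2 w - σ2 with hψ2
  have hψd : ∀ w, HasDerivAt ψ (ψ1 w) w := by
    intro w
    have h2 : HasDerivAt (fun w : ℝ => m * w) m w := by simpa using (hasDerivAt_id w).const_mul m
    have h3 : HasDerivAt (fun w : ℝ => σ2 * (w * w) / 2) (σ2 * w) w := by
      have h := (((hasDerivAt_id' w).mul (hasDerivAt_id' w)).const_mul σ2).div_const 2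
      exact h.congr_deriv (by ring)
    exact (((hΛd' w).sub_const (Λ 0)).sub h2).sub h3
  have hψ1d : ∀ w, HasDerivAt ψ1 (ψ2 w) w := by
    intro w
    have h3 : HasDerivAt (fun w : ℝ => σ2 * w) σ2 w := by simpa using (hasDerivAt_id w).const_mul σ2
    exact ((hΛdd' w).sub_const m).sub h3
  have hψ0 : ψ 0 = 0 := by simp [hψ]
  have hψ10 : ψ1 0 = 0 := by simp [hψ1, hmΛ]
  -- T1: `N ψ(u_N) → 0`
  have T1 : Tendsto (fun N : ℕ => (N : ℝ) * ψ (u N)) atTop (𝓝 0) := by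
    rw [Metric.tendsto_atTop]
    intro e he
    have hη : 0 < e / (s ^ 2 + 1) := by positivity
    have hc : ContinuousAt ψ2 0 := (hΛ2c.sub continuous_const).continuousAt
    have hψ20 : ψ2 0 = 0 := by simp [hψ2, hσΛ]
    obtain ⟨δ, hδ, hδb⟩ := (Metric.continuousAt_iff.1 hc) (e / (s ^ 2 + 1)) hη
    have hbound : ∀ w ∈ Icc (-(δ / 2)) (δ / 2), |ψ2 w| ≤ e / (s ^ 2 + 1) := by
      intro w hw
      have : dist w 0 < δ := by rw [Real.dist_eq, sub_zero]; exact lt_of_le_of_lt (abs_le.2 ⟨hw.1, hw.2⟩) (by linarith)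
      have h := hδb this
      rw [hψ20, Real.dist_eq, sub_zero] at h
      exact h.le
    obtain ⟨N₀, hN₀⟩ := (Metric.tendsto_atTop.1 hu0) (δ / 2) (by positivity)
    refine ⟨max N₀ 1, fun N hN => ?_⟩
    have hN1 : 1 ≤ N := le_trans (le_max_right _ _) hN
    have huδ : u N ∈ Icc (-(δ / 2)) (δ / 2) := by
      have := hN₀ N (le_trans (le_max_left _ _) hN)
      rw [Real.dist_eq, sub_zero] at this
      exact ⟨by linarith [neg_abs_le (u N)], by linarith [le_abs_self (u N)]⟩
    have hψb := abs_le_of_second_deriv_bound_cw hψ0 hψ10 hψd hψ1d hbound huδ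
    rw [Real.dist_eq, sub_zero, abs_mul, abs_of_nonneg (Nat.cast_nonneg N)]
    calc (N : ℝ) * |ψ (u N)| ≤ (N : ℝ) * (e / (s ^ 2 + 1) * u N ^ 2) := mul_le_mul_of_nonneg_left hψb (Nat.cast_nonneg N)
      _ = e / (s ^ 2 + 1) * ((N : ℝ) * u N ^ 2) := by ring
      _ = e / (s ^ 2 + 1) * s ^ 2 := by rw [(huN N hN1).2]
      _ < e := by
          rw [div_mul_eq_mul_div, div_lt_iff₀ (by positivity)]
          nlinarith
  -- T2: the amplitude correction along the line is continuous at `0`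
  set LA : ℕ → ℝ → ℝ := fun c w => Real.log (parityAmplitude c (Real.exp (A₀ + w * v₁)) (Real.exp (B₀ + w * v₂))) with hLA
  have T2 : ∀ c, c < 2 → Tendsto (fun N : ℕ => LA c (u N) - LA c 0) atTop (𝓝 0) := by
    intro c hc
    have hG2 := contDiff_two_parityG_line A₀ B₀ v₁ v₂ hc
    have hcont : Continuous (LA c) := by
      have h1 : Continuous (fun t => (c : ℝ) * Real.log (stripMuY₂ 1 (Real.exp (A₀ + t * v₁)) (Real.exp (B₀ + t * v₂)))
          + Real.log (parityAmplitude c (Real.exp (A₀ + t * v₁)) (Real.exp (B₀ + t * v₂)))) := hG2.continuous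
      have hΛc : Continuous Λ := by rw [hΛdef]; exact hΛC2.continuous
      have h2 : Continuous (fun t => (c : ℝ) * Λ t) := continuous_const.mul hΛc
      have e : LA c = fun t => ((c : ℝ) * Real.log (stripMuY₂ 1 (Real.exp (A₀ + t * v₁)) (Real.exp (B₀ + t * v₂)))
          + Real.log (parityAmplitude c (Real.exp (A₀ + t * v₁)) (Real.exp (B₀ + t * v₂)))) - (c : ℝ) * Λ t := by
        funext t; simp only [hLA, hΛdef]; ring
      rw [e]; exact h1.sub h2
    have := ((hcont.tendsto 0).comp hu0).sub_const (LA c 0)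
    rwa [Function.comp_def, sub_self] at this
  -- T3: the uniform remainders on the rectangle containing the segment `|w| ≤ 1`
  set y₁ := Real.exp (A₀ - |v₁|) with hy₁def
  set y₂ := Real.exp (A₀ + |v₁|) with hy₂def
  set z₁ := Real.exp (B₀ - |v₂|) with hz₁def
  set z₂ := Real.exp (B₀ + |v₂|) with hz₂def
  have hy₁ : 0 < y₁ := Real.exp_pos _
  have hz₁ : 0 < z₁ := Real.exp_pos _
  have h12 : y₁ ≤ y₂ := Real.exp_le_exp.2 (by linarith [abs_nonneg v₁])
  have hz12 : z₁ ≤ z₂ := Real.exp_le_exp.2 (by linarith [abs_nonneg v₂])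
  have hrem : ∀ c, c < 2 → ∃ ε : ℕ → ℝ, Tendsto ε atTop (𝓝 0) ∧ ∀ M : ℕ, ∀ y' ∈ Icc y₁ y₂, ∀ z' ∈ Icc z₁ z₂,
      |Real.log (stripZ₂ 1 (2 * M + c) y' z') - (2 * M + c) * Real.log (stripMuY₂ 1 y' z') - Real.log (parityAmplitude c y' z')| ≤ ε M := by
    intro c hc
    obtain ⟨a₁, a₂, ha₁, hA⟩ := parityAmplitude_bounds_rect hy₁ h12 hz₁ hz12 hc
    obtain ⟨ε, hεlim, hεb⟩ := exists_uniform_log_two_term_rect hy₁ h12 hz₁ hz12 hc ha₁ hA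
      (fun y' hy' z' hz' => tendsto_parityAmplitude (lt_of_lt_of_le hy₁ hy'.1) (lt_of_lt_of_le hz₁ hz'.1) hc)
    refine ⟨ε, ?_, hεb⟩
    have hε0 : ∀ M, 0 ≤ ε M := fun M => le_trans (abs_nonneg _) (hεb M y₁ ⟨le_rfl, h12⟩ z₁ ⟨le_rfl, hz12⟩)
    refine squeeze_zero' (Filter.Eventually.of_forall hε0) ?_ hεlim
    filter_upwards [eventually_ge_atTop 1] with M hM
    have hM1' : (1 : ℝ) ≤ M := by exact_mod_cast hM
    nlinarith [hε0 M]
  obtain ⟨ε0, hε0lim, hε0b⟩ := hrem 0 (by norm_num)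
  obtain ⟨ε1, hε1lim, hε1b⟩ := hrem 1 (by norm_num)
  have hmemI : ∀ w : ℝ, |w| ≤ 1 → Real.exp (A₀ + w * v₁) ∈ Icc y₁ y₂ ∧ Real.exp (B₀ + w * v₂) ∈ Icc z₁ z₂ := by
    intro w hw
    have b1 : |w * v₁| ≤ |v₁| := by
      rw [abs_mul]; exact (mul_le_mul_of_nonneg_right hw (abs_nonneg _)).trans (by rw [one_mul])
    have b2 : |w * v₂| ≤ |v₂| := by
      rw [abs_mul]; exact (mul_le_mul_of_nonneg_right hw (abs_nonneg _)).trans (by rw [one_mul])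
    obtain ⟨b1l, b1u⟩ := abs_le.1 b1
    obtain ⟨b2l, b2u⟩ := abs_le.1 b2
    exact ⟨⟨Real.exp_le_exp.2 (by linarith), Real.exp_le_exp.2 (by linarith)⟩,
      ⟨Real.exp_le_exp.2 (by linarith), Real.exp_le_exp.2 (by linarith)⟩⟩
  -- the total error bound
  set bound : ℕ → ℝ := fun N => |(N : ℝ) * ψ (u N)| + (|LA 0 (u N) - LA 0 0| + |LA 1 (u N) - LA 1 0|)
      + 2 * (|ε0 (N / 2)| + |ε1 (N / 2)|) with hbound
  have hbound0 : Tendsto bound atTop (𝓝 0) := by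
    have a := T1.abs
    have b0 := (T2 0 (by norm_num)).abs
    have b1 := (T2 1 (by norm_num)).abs
    have c0 := (hε0lim.comp tendsto_nat_div_two_cw).abs
    have c1 := (hε1lim.comp tendsto_nat_div_two_cw).abs
    simp only [abs_zero] at a b0 b1 c0 c1
    have := (a.add (b0.add b1)).add ((c0.add c1).const_mul 2)
    simp only [add_zero, mul_zero] at this
    exact this
  -- the key estimate, eventually in `N`
  have hkey : ∀ᶠ N : ℕ in atTop,
      |Real.log (stripZ₂ 1 N (y * Real.exp (u N * v₁)) (z * Real.exp (u N * v₂)) / stripZ₂ 1 N y z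
          * Real.exp (-(s * Real.sqrt N * m))) - σ2 * s ^ 2 / 2| ≤ bound N := by
    obtain ⟨N₀, hN₀⟩ := (Metric.tendsto_atTop.1 hu0) 1 one_pos
    filter_upwards [eventually_ge_atTop (max N₀ 1)] with N hN
    have hN1 : 1 ≤ N := le_trans (le_max_right _ _) hN
    have huv : |u N| ≤ 1 := by
      have := hN₀ N (le_trans (le_max_left _ _) hN); rw [Real.dist_eq, sub_zero] at this; exact this.le
    obtain ⟨M, c, hc, hNMc⟩ : ∃ M c : ℕ, c < 2 ∧ N = 2 * M + c := ⟨N / 2, N % 2, Nat.mod_lt _ (by norm_num), (Nat.div_add_mod N 2).symm⟩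
    have hMdiv : N / 2 = M := by omega
    have hC1 := stripZ₂_pos 1 N (mul_pos hy (Real.exp_pos (u N * v₁))) (mul_pos hz (Real.exp_pos (u N * v₂)))
    have hC0 := stripZ₂_pos 1 N hy hz
    have hE := Real.exp_pos (-(s * Real.sqrt N * m))
    obtain ⟨ey1, ez1⟩ := ept (u N)
    have ey0 : y = Real.exp (A₀ + 0 * v₁) := by rw [zero_mul, add_zero, hyA]
    have ez0 : z = Real.exp (B₀ + 0 * v₂) := by rw [zero_mul, add_zero, hzB]
    have eNr : (N : ℝ) = 2 * (M : ℝ) + c := by rw [hNMc]; push_cast; ring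
    have hrem2 : ∀ w : ℝ, |w| ≤ 1 →
        |Real.log (stripZ₂ 1 N (Real.exp (A₀ + w * v₁)) (Real.exp (B₀ + w * v₂))) - N * Λ w - LA c w| ≤ |ε0 (N / 2)| + |ε1 (N / 2)| := by
      intro w hw
      have eΛ : Λ w = Real.log (stripMuY₂ 1 (Real.exp (A₀ + w * v₁)) (Real.exp (B₀ + w * v₂))) := by rw [hΛdef]
      obtain ⟨hmy, hmz⟩ := hmemI w hw
      rw [eΛ, hMdiv, eNr]
      interval_cases c
      · have key := hε0b M _ hmy _ hmz
        rw [← hNMc] at key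
        push_cast at key ⊢
        simp only [add_zero] at key ⊢
        exact le_trans key (by linarith [le_abs_self (ε0 M), abs_nonneg (ε1 M)])
      · have key := hε1b M _ hmy _ hmz
        rw [← hNMc] at key
        push_cast at key ⊢
        exact le_trans key (by linarith [le_abs_self (ε1 M), abs_nonneg (ε0 M)])
    have hr1 := hrem2 (u N) huv
    have hr0 := hrem2 0 (by simp)
    have hlog : Real.log (stripZ₂ 1 N (y * Real.exp (u N * v₁)) (z * Real.exp (u N * v₂)) / stripZ₂ 1 N y z
          * Real.exp (-(s * Real.sqrt N * m)))
        = Real.log (stripZ₂ 1 N (Real.exp (A₀ + u N * v₁)) (Real.exp (B₀ + u N * v₂)))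
          - Real.log (stripZ₂ 1 N (Real.exp (A₀ + 0 * v₁)) (Real.exp (B₀ + 0 * v₂))) - s * Real.sqrt N * m := by
      rw [Real.log_mul (div_pos hC1 hC0).ne' hE.ne', Real.log_div hC1.ne' hC0.ne', Real.log_exp, ey1, ez1, ← ey0, ← ez0]
      ring
    obtain ⟨e1, e2⟩ := huN N hN1
    have hid : Real.log (stripZ₂ 1 N (Real.exp (A₀ + u N * v₁)) (Real.exp (B₀ + u N * v₂)))
          - Real.log (stripZ₂ 1 N (Real.exp (A₀ + 0 * v₁)) (Real.exp (B₀ + 0 * v₂))) - s * Real.sqrt N * m - σ2 * s ^ 2 / 2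
        = (N : ℝ) * ψ (u N) + (LA c (u N) - LA c 0)
          + ((Real.log (stripZ₂ 1 N (Real.exp (A₀ + u N * v₁)) (Real.exp (B₀ + u N * v₂))) - N * Λ (u N) - LA c (u N))
            - (Real.log (stripZ₂ 1 N (Real.exp (A₀ + 0 * v₁)) (Real.exp (B₀ + 0 * v₂))) - N * Λ 0 - LA c 0)) := by
      simp only [hψ]
      have e1' : s * Real.sqrt N * m = (N : ℝ) * u N * m := by rw [e1]
      have e2' : σ2 * s ^ 2 / 2 = (N : ℝ) * u N ^ 2 * σ2 / 2 := by rw [e2]; ring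
      rw [e1', e2']
      ring
    rw [hlog, hid, hbound]
    have hcases : |LA c (u N) - LA c 0| ≤ |LA 0 (u N) - LA 0 0| + |LA 1 (u N) - LA 1 0| := by
      interval_cases c
      · linarith [abs_nonneg (LA 1 (u N) - LA 1 0)]
      · linarith [abs_nonneg (LA 0 (u N) - LA 0 0)]
    calc |(N : ℝ) * ψ (u N) + (LA c (u N) - LA c 0)
          + ((Real.log (stripZ₂ 1 N (Real.exp (A₀ + u N * v₁)) (Real.exp (B₀ + u N * v₂))) - N * Λ (u N) - LA c (u N))
            - (Real.log (stripZ₂ 1 N (Real.exp (A₀ + 0 * v₁)) (Real.exp (B₀ + 0 * v₂))) - N * Λ 0 - LA c 0))|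
        ≤ |(N : ℝ) * ψ (u N)| + |LA c (u N) - LA c 0|
          + (|Real.log (stripZ₂ 1 N (Real.exp (A₀ + u N * v₁)) (Real.exp (B₀ + u N * v₂))) - N * Λ (u N) - LA c (u N)|
            + |Real.log (stripZ₂ 1 N (Real.exp (A₀ + 0 * v₁)) (Real.exp (B₀ + 0 * v₂))) - N * Λ 0 - LA c 0|) := by
          refine le_trans (abs_add_le _ _) (add_le_add (abs_add_le _ _) (abs_sub _ _))
      _ ≤ _ := by linarith [hcases, hr1, hr0]
  -- conclude
  have hlogT : Tendsto (fun N : ℕ => Real.log (stripZ₂ 1 N (y * Real.exp (u N * v₁)) (z * Real.exp (u N * v₂)) / stripZ₂ 1 N y z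
      * Real.exp (-(s * Real.sqrt N * m)))) atTop (𝓝 (σ2 * s ^ 2 / 2)) := by
    have h := squeeze_zero_norm' (hkey.mono fun N hN => by rw [Real.norm_eq_abs]; exact hN) hbound0
    exact tendsto_sub_nhds_zero_iff.1 h
  have hexpT := (Real.continuous_exp.tendsto _).comp hlogT
  refine hexpT.congr' ?_
  filter_upwards [eventually_ge_atTop 1] with N hN
  have hC1 := stripZ₂_pos 1 N (mul_pos hy (Real.exp_pos (u N * v₁))) (mul_pos hz (Real.exp_pos (u N * v₂)))
  have hC0 := stripZ₂_pos 1 N hy hz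
  simp only [Function.comp_apply, hu]
  exact Real.exp_log (mul_pos (div_pos hC1 hC0) (Real.exp_pos _))

/-! ## §2 ★★★★ The law of the centred scaled linear statistic converges weakly to `N(0, H(v))` -/

/-- **The law of `(v₁bc + v₂tc − N m_v)/√N` under `P_{N,y,z}`** as a measure on `ℝ` (`finLaw` of CAR «CONTACT CLT»).
[cite: BeatonBousquetMelouDeGierDuminilCopinGuttmann2014, §3.2 (arXiv v5 p. 10: the weights y^{bc} z^{tc}); Durrett2019, §3.2 (lane statement)] -/
def linLaw (v₁ v₂ y z : ℝ) (N : ℕ) : Measure ℝ :=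
  finLaw (stripPairs 1 N) (fun q => wgt y z N q / stripZ₂ 1 N y z)
    (fun q => (v₁ * (bottomVisits₀ q.1 q.2 N : ℝ) + v₂ * (topVisits₀ 1 q.1 q.2 N : ℝ)
      - N * (v₁ * contactB y z + v₂ * contactB z y)) / Real.sqrt N)

/-- `linLaw` is a probability measure for `y, z > 0`. [cite: BeatonBousquetMelouDeGierDuminilCopinGuttmann2014, §3.2 (lane plumbing)] -/
theorem isProbabilityMeasure_linLaw (hy : 0 < y) (hz : 0 < z) (v₁ v₂ : ℝ) (N : ℕ) : IsProbabilityMeasure (linLaw v₁ v₂ y z N) := by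
  refine isProbabilityMeasure_finLaw _ _ (wgt_div_nonneg hy hz N) ?_
  rw [← Finset.sum_div, ← stripZ₂_one_eq_sum_wgt, div_self (stripZ₂_pos 1 N hy hz).ne']

/-- ★ **The mgf of `linLaw` is the quotient of `tendsto_linMGF_gaussian`**:
`∫ e^{sx} d(linLaw) = C_{1,N}(y e^{(s/√N)v₁}, z e^{(s/√N)v₂})/C_{1,N}(y,z) · e^{−s√N m_v}`.
[cite: DemboZeitouni2010, §2.2 (exponential tilt; lane statement); BeatonBousquetMelouDeGierDuminilCopinGuttmann2014, §3.2 (arXiv v5 p. 10)] -/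
theorem integral_exp_mul_linLaw (hy : 0 < y) (hz : 0 < z) (v₁ v₂ : ℝ) (N : ℕ) (s : ℝ) :
    ∫ x, Real.exp (s * x) ∂linLaw v₁ v₂ y z N =
      stripZ₂ 1 N (y * Real.exp (s / Real.sqrt N * v₁)) (z * Real.exp (s / Real.sqrt N * v₂)) / stripZ₂ 1 N y z
        * Real.exp (-(s * Real.sqrt N * (v₁ * contactB y z + v₂ * contactB z y))) := by
  rw [linLaw, integral_finLaw _ _ (wgt_div_nonneg hy hz N), stripZ₂_one_tilt₂_eq_sum, Finset.sum_div, Finset.sum_mul]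
  refine Finset.sum_congr rfl fun q _ => ?_
  set L := v₁ * (bottomVisits₀ q.1 q.2 N : ℝ) + v₂ * (topVisits₀ 1 q.1 q.2 N : ℝ)
  set mm := v₁ * contactB y z + v₂ * contactB z y
  have hsq : (N : ℝ) / Real.sqrt N = Real.sqrt N := Real.div_sqrt
  have hexp : Real.exp (s * ((L - N * mm) / Real.sqrt N)) = Real.exp (s / Real.sqrt N * L) * Real.exp (-(s * Real.sqrt N * mm)) := by
    rw [← Real.exp_add]
    congr 1
    have e1 : s * ((L - N * mm) / Real.sqrt N) = s / Real.sqrt N * L - s * mm * ((N : ℝ) / Real.sqrt N) := by ring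
    rw [e1, hsq]
    ring
  rw [hexp]
  ring

open Classical in
/-- **The distribution function of `linLaw` is the tail quotient**: for `N ≥ 1`,
`linLaw(−∞, x] = Σ_{q : L(q) ≤ N m_v + x√N} wgt(q)/C_{1,N} = P_{N,y,z}(v₁bc + v₂tc ≤ N m_v + x√N)`.
[cite: Durrett2019, §3.2 (distribution functions; lane plumbing); BeatonBousquetMelouDeGierDuminilCopinGuttmann2014, §3.2] -/
theorem linLaw_real_Iic (hy : 0 < y) (hz : 0 < z) (v₁ v₂ : ℝ) {N : ℕ} (hN : 1 ≤ N) (x : ℝ) :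
    (linLaw v₁ v₂ y z N).real (Iic x) =
      (∑ q ∈ (stripPairs 1 N).filter (fun q => v₁ * (bottomVisits₀ q.1 q.2 N : ℝ) + v₂ * (topVisits₀ 1 q.1 q.2 N : ℝ)
          ≤ N * (v₁ * contactB y z + v₂ * contactB z y) + x * Real.sqrt N), wgt y z N q) / stripZ₂ 1 N y z := by
  rw [linLaw, finLaw_real_apply _ _ (wgt_div_nonneg hy hz N), Finset.sum_div]
  have hsq : 0 < Real.sqrt (N : ℝ) := Real.sqrt_pos.2 (by exact_mod_cast hN)
  refine Finset.sum_congr (Finset.filter_congr fun q _ => ?_) fun _ _ => rfl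
  rw [Set.mem_Iic, div_le_iff₀ hsq]
  constructor <;> intro h <;> linarith

/-- ★★★★ **CRAMÉR–WOLD FORM OF THE JOINT CLT OF THE TWO CONTACT NUMBERS.**  For all `y, z > 0` and EVERY direction `(v₁, v₂)`: the law of
`(v₁·bc + v₂·tc − N·m_v)/√N` under `P_{N,y,z}` converges weakly to the centred Gaussian of variance `H_{y,z}(v)` (the free-energy Hessian as a
quadratic form; for `v = 0` both sides are `δ₀`).  Proof: `tendsto_linMGF_gaussian` + Curtiss' continuity theorem `tendsto_gaussianReal_of_tendsto_mgf`.
[cite: Curtiss1942, Theorem 3; DemboZeitouni2010, §2.3 (lane statement); BeatonBousquetMelouDeGierDuminilCopinGuttmann2014, §3.2 Proposition 6 (arXiv v5 p. 10); JansevanRensburg2000, §3.3 (1st ed.)] -/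
theorem tendsto_linLaw (hy : 0 < y) (hz : 0 < z) (v₁ v₂ : ℝ) :
    Tendsto (β := ProbabilityMeasure ℝ) (fun N : ℕ => ⟨linLaw v₁ v₂ y z N, isProbabilityMeasure_linLaw hy hz v₁ v₂ N⟩) atTop
      (𝓝 ⟨gaussianReal 0 (contactHess v₁ v₂ y z).toNNReal, inferInstance⟩) := by
  set σ2 := contactHess v₁ v₂ y z with hσ2
  have hσ : 0 ≤ σ2 := by
    by_cases hv : (v₁, v₂) = (0, 0)
    · obtain ⟨h1, h2⟩ : v₁ = 0 ∧ v₂ = 0 := by simpa using hv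
      subst h1; subst h2
      simp [hσ2, contactHess]
    · exact (contactHess_pos hy hz hv).le
  refine tendsto_gaussianReal_of_tendsto_mgf 0 σ2.toNNReal one_pos (fun s _ N => integrable_finLaw _ _ _ _) fun s _ => ?_
  have h := tendsto_linMGF_gaussian hy hz v₁ v₂ s
  rw [show Real.exp (σ2 * s ^ 2 / 2) = Real.exp (0 * s + (σ2.toNNReal : ℝ) * s ^ 2 / 2) by
    rw [Real.coe_toNNReal _ hσ, zero_mul, zero_add]] at h
  refine h.congr fun N => ?_
  rw [ProbabilityMeasure.coe_mk, integral_exp_mul_linLaw hy hz]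

open Classical in
/-- ★★★ **CLT FOR EVERY LINEAR CONTACT STATISTIC, DISTRIBUTION FUNCTIONS**: for `y, z > 0`, `(v₁,v₂) ≠ 0` and every real `x`,
`P_{N,y,z}(v₁bc + v₂tc ≤ N·m_v + x√N) → N(0, H_{y,z}(v))(−∞, x]`.
[cite: Curtiss1942, Theorem 3; Durrett2019, §3.2 Theorem 3.2.11 (iv) (book p. 124); DemboZeitouni2010, §2.3 (lane statement)] -/
theorem tendsto_linCDF (hy : 0 < y) (hz : 0 < z) {v₁ v₂ : ℝ} (hv : (v₁, v₂) ≠ (0, 0)) (x : ℝ) :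
    Tendsto (fun N : ℕ =>
        (∑ q ∈ (stripPairs 1 N).filter (fun q => v₁ * (bottomVisits₀ q.1 q.2 N : ℝ) + v₂ * (topVisits₀ 1 q.1 q.2 N : ℝ)
            ≤ N * (v₁ * contactB y z + v₂ * contactB z y) + x * Real.sqrt N), wgt y z N q) / stripZ₂ 1 N y z) atTop
      (𝓝 ((gaussianReal 0 (contactHess v₁ v₂ y z).toNNReal).real (Iic x))) := by
  have hσ : 0 < contactHess v₁ v₂ y z := contactHess_pos hy hz hv
  have hvv : (contactHess v₁ v₂ y z).toNNReal ≠ 0 := by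
    rw [ne_eq, Real.toNNReal_eq_zero, not_le]; exact hσ
  have h := @tendsto_measureReal_Iic_of_tendsto _
    ⟨gaussianReal 0 (contactHess v₁ v₂ y z).toNNReal, inferInstance⟩
    (nullSingletonClass_gaussianReal hvv) (tendsto_linLaw hy hz v₁ v₂) x
  simp only [ProbabilityMeasure.coe_mk] at h
  refine h.congr' ?_
  filter_upwards [eventually_ge_atTop 1] with N hN
  exact linLaw_real_Iic hy hz v₁ v₂ hN x

/-! ## §3 ★★★ The total number of surface contacts -/

open Classical in
/-- ★★★ **CLT FOR THE TOTAL NUMBER OF SURFACE CONTACTS**: for all `y, z > 0` and every real `x`,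
`P_{N,y,z}(bc + tc ≤ N·(b(y,z) + b(z,y)) + x√N) → N(0, H_{y,z}(1,1))(−∞, x]`, `H(1,1) = (m₁₁ − 2m₁₂ + m₂₂)/D > 0` (the variance rate of
`tendsto_varTotalContacts_div`). [cite: Curtiss1942, Theorem 3; DemboZeitouni2010, §2.3 (lane statement); JansevanRensburg2000, §3.3 (1st ed.)] -/
theorem tendsto_totalContactCDF (hy : 0 < y) (hz : 0 < z) (x : ℝ) :
    Tendsto (fun N : ℕ =>
        (∑ q ∈ (stripPairs 1 N).filter (fun q => (bottomVisits₀ q.1 q.2 N : ℝ) + (topVisits₀ 1 q.1 q.2 N : ℝ)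
            ≤ N * (contactB y z + contactB z y) + x * Real.sqrt N), wgt y z N q) / stripZ₂ 1 N y z) atTop
      (𝓝 ((gaussianReal 0 (contactHess 1 1 y z).toNNReal).real (Iic x))) := by
  have h := tendsto_linCDF hy hz (v₁ := 1) (v₂ := 1) (by simp) x
  refine h.congr fun N => ?_
  simp only [one_mul]

open Classical in
/-- ★★★ The same with the Gaussian integral displayed: `P_{N,y,z}(bc + tc ≤ N(b + b') + x√N) → ∫_{(−∞,x]} φ_{0,H(1,1)}(t) dt`.
[cite: Curtiss1942, Theorem 3; Durrett2019, §3.1 (Gaussian density), §3.2 Theorem 3.2.11 (iv) (book p. 124); DemboZeitouni2010, §2.3 (lane statement)] -/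
theorem tendsto_totalContactCDF' (hy : 0 < y) (hz : 0 < z) (x : ℝ) :
    Tendsto (fun N : ℕ =>
        (∑ q ∈ (stripPairs 1 N).filter (fun q => (bottomVisits₀ q.1 q.2 N : ℝ) + (topVisits₀ 1 q.1 q.2 N : ℝ)
            ≤ N * (contactB y z + contactB z y) + x * Real.sqrt N), wgt y z N q) / stripZ₂ 1 N y z) atTop
      (𝓝 (∫ t in Iic x, gaussianPDFReal 0 (contactHess 1 1 y z).toNNReal t)) := by
  have hσ : 0 < contactHess 1 1 y z := contactHess_pos hy hz (by simp)
  have hvv : (contactHess 1 1 y z).toNNReal ≠ 0 := by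
    rw [ne_eq, Real.toNNReal_eq_zero, not_le]; exact hσ
  have hI : (gaussianReal 0 (contactHess 1 1 y z).toNNReal).real (Iic x) = ∫ t in Iic x, gaussianPDFReal 0 (contactHess 1 1 y z).toNNReal t := by
    rw [measureReal_def, gaussianReal_apply_eq_integral 0 hvv, ENNReal.toReal_ofReal]
    exact setIntegral_nonneg measurableSet_Iic fun t _ => gaussianPDFReal_nonneg _ _ t
  rw [← hI]
  exact tendsto_totalContactCDF hy hz x

end WidthOneYZ

end Literature.Probability.RandomPlanarGeometry.SAW.HexBW

end
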